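import Literature.AlgebraicGeometry.ShimuraVarieties.Deligne1979ComplexPoints
import Literature.AlgebraicGeometry.HodgeTheory.HardLefschetzPureDimensional
import Literature.AlgebraicGeometry.HodgeTheory.TopDegreeClasses
import HarnessLib

/-!
# The components of a smooth projective complex model of `Sh_K(ℂ)` are indexed by `Ξ_K`

Deligne 1979, §2.1.2–2.1.3 for the unitary datum `(U(H), 𝔹²)` of a hermitian `3`-space over a CM field
`L`, read on an algebraic MODEL: let `X` be a complex scheme, smooth of relative dimension `d` over `ℂ`
and projective (NOT assumed irreducible — Shimura varieties are not geometrically connected), together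
with a homeomorphism `e : X(ℂ) ≃ₜ Sh_K(ℂ) = U(H)(L⁺) \ [𝔹² × U(H)(𝔸_{L⁺,f})/K]`, `K` open.  Then, for
any representatives `g_q` of the classes `q ∈ Ξ_K = U(H)(L⁺) \ U(H)(𝔸_{L⁺,f}) / K`:

* `Deligne1979.image_eq_piece_of_isClopen` — `e` carries every clopen connected subset of `X(ℂ)` onto a
  piece `{[z, aK] : z ∈ 𝔹²}` (the pieces are the connected components, `Deligne1979.connectedComponent_mk`);
* `Deligne1979.exists_components_indexed` — `X` is the disjoint union of open-and-closed subschemes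
  `E_q ↪ X` INDEXED BY `q ∈ Ξ_K`, each a smooth projective geometrically irreducible `d`-fold
  (`Motives.IsSmoothProjective d (E_q)`), whose complex points form a clopen partition of `X(ℂ)` and
  are carried by `e` exactly onto the piece of `g_q`: `e(E_q(ℂ)) = {[z, g_q K]}` — the scheme-level
  form of "`Sh_K(ℂ)` is a disjoint sum, indexed by `Ξ_K`, of the `Γ_{g_q} \ 𝔹²`";
* `Deligne1979.exists_components_homeomorph_ballQuotient` — moreover `E_q(ℂ) ≃ₜ Δ(Γ_H(g_q K g_q⁻¹)) \ 𝔹²`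
  compatibly with `e` (`[z] ↦ e⁻¹[z, g_q K]`).

Ingredients (all tree theorems): the decomposition of a pure-dimensional smooth projective complex
scheme into its irreducible components as open-closed smooth projective varieties
(`HodgeTheory.exists_components_isSmoothProjective`, Görtz–Wedhorn I Ex. 3.16), connectedness of the
complex points of each (`HodgeTheory.connectedSpace_complexPoints`, SGA1 XII 2.4), the dissection
`UnitaryGroup.shimuraSetHomeomorph` and `Deligne1979.connectedComponents_equiv_index`.

Use (cells pub-hodgecm / pub-hodgecm2, S2 residual (R1)): from ONE model carrier `M` over the reflex
field with `M(ℂ) ≃ₜ Sh_K(ℂ)` these theorems produce the per-component surfaces `X_c : SchemeOver ℂ`,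
`IsSmoothProjective 2 (X_c)`, indexed by `Ξ_K` and homeomorphic to the ball quotients by the CONJUGATE
levels `Γ_H(g_q K g_q⁻¹)` — the topological half of a component presentation; holomorphy of the
uniformisations is not addressed here.  THEOREMS ONLY; no definition, no named fact.

## References
* [Deligne1979ShimuraVarieties] P. Deligne, *Variétés de Shimura*, Proc. Symp. Pure Math. 33.2 (1979), §2.1.2–2.1.3.
* [Milne2005ShimuraVarieties] J. S. Milne, *Introduction to Shimura varieties* (2005), Lemma 5.13.
* [GortzWedhorn2020] U. Görtz, T. Wedhorn, *Algebraic Geometry I* (2nd ed. 2020), Exercise 3.16.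
-/

set_option autoImplicit false

noncomputable section

open Function MulAction Topology NumberField CategoryTheory AlgebraicGeometry
open Literature.AlgebraicGeometry.Motives
open Literature.AlgebraicTopology.SingularHomology (IsClopenPartition)
open Literature.NumberTheory.Automorphic Literature.NumberTheory.Automorphic.UnitaryGroup
open Literature.NumberTheory.Automorphic.ShimuraDissection
open Literature.Geometry.ComplexHyperbolic Literature.Geometry.ComplexHyperbolic.BallModel

namespace Literature.AlgebraicGeometry.ShimuraVarieties

/-! ### Point-set lemmas (private helpers) -/

/-- A homeomorphism carries connected components to connected components. [folklore] -/
private theorem image_connectedComponent_homeomorph {X Y : Type*} [TopologicalSpace X] [TopologicalSpace Y]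
    (e : X ≃ₜ Y) (x : X) : e '' connectedComponent x = connectedComponent (e x) := by
  refine Set.Subset.antisymm (e.continuous.image_connectedComponent_subset x) ?_
  have h := e.symm.continuous.image_connectedComponent_subset (e x)
  rw [e.symm_apply_apply] at h
  calc connectedComponent (e x) = e '' (e.symm '' connectedComponent (e x)) :=
        (e.image_symm_image _).symm
    _ ⊆ e '' connectedComponent x := Set.image_mono h

/-- A clopen preconnected set containing `x` is the connected component of `x`. [folklore] -/
private theorem eq_connectedComponent_of_isClopen {X : Type*} [TopologicalSpace X] {S : Set X}
    (hS : IsClopen S) (hc : IsPreconnected S) {x : X} (hx : x ∈ S) : S = connectedComponent x :=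
  Set.Subset.antisymm (hc.subset_connectedComponent hx) (hS.connectedComponent_subset hx)

/-- The pieces of a clopen partition are closed (the complement of a piece is the union of the other,
open, pieces). [folklore] -/
private theorem isClosed_of_isClopenPartition {Z : Type*} [TopologicalSpace Z] {ι : Type*} {A : ι → Set Z}
    (h : IsClopenPartition A) (k : ι) : IsClosed (A k) := by
  rw [← isOpen_compl_iff, isOpen_iff_forall_mem_open]
  intro z hz
  obtain ⟨j, hj⟩ := h.exists_mem z
  have hjk : j ≠ k := fun hjk => hz (hjk ▸ hj)
  exact ⟨A j, fun w hw hwk => Set.disjoint_left.mp (h.disjoint hjk) hw hwk, h.isOpen j, hj⟩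

namespace Deligne1979

variable (L : Type) [Field L] [NumberField L] [IsCMField L] (H : Matrix (Fin 3) (Fin 3) L)
  (τ : L →+* ℂ) (T : GL (Fin 3) ℂ) (hT : formCongr (starRingEnd ℂ) T (H.map τ) = BallModel.J)
  (K : Subgroup (finAdelic (↥(maximalRealSubfield L)) L (IsCMField.complexConj L) 3 H))

/-! ### Clopen connected subsets go to pieces -/

/-- **A homeomorphism onto `Sh_K(ℂ)` carries every clopen connected set onto a piece** `{[z, aK]}`:
the pieces are exactly the connected components of `Sh_K(ℂ)` (Deligne 1979 §2.1.3, the tree's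
`connectedComponent_mk`), and a clopen connected set is a connected component.
[cite: Deligne1979ShimuraVarieties, §2.1.3] -/
theorem image_eq_piece_of_isClopen {Y : Type*} [TopologicalSpace Y]
    (hK : IsOpen (K : Set (finAdelic (↥(maximalRealSubfield L)) L (IsCMField.complexConj L) 3 H)))
    (e : Y ≃ₜ ShimuraSet L H τ T hT K) {S : Set Y} (hS : IsClopen S) (hc : IsConnected S) :
    ∃ a : finAdelic (↥(maximalRealSubfield L)) L (IsCMField.complexConj L) 3 H,
      e '' S = Set.range (fun z : Ball => ShimuraSet.mk L H τ T hT K z a) := by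
  obtain ⟨y, hy⟩ := hc.nonempty
  obtain ⟨⟨z, a⟩, hza⟩ := ShimuraSet.mk_surjective L H τ T hT K (e y)
  refine ⟨a, ?_⟩
  rw [eq_connectedComponent_of_isClopen hS hc.isPreconnected hy, image_connectedComponent_homeomorph,
    ← connectedComponent_mk L H τ T hT K hK z a]
  simp only [Function.uncurry_apply_pair] at hza
  rw [hza]

/-! ### The components of a model, indexed by `Ξ_K` -/

/-- **The components of a smooth projective complex model of `Sh_K(ℂ)` are smooth projective varieties
indexed by `Ξ_K`, matching the pieces.**  Let `X` be smooth of relative dimension `d` over `ℂ` and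
projective, `e : X(ℂ) ≃ₜ Sh_K(ℂ)` a homeomorphism (`K` open) and `g_q` representatives of
`Ξ_K = U(H)(L⁺) \ U(H)(𝔸_{L⁺,f}) / K`.  Then there are open-and-closed subschemes `E_q ↪ X`, `q ∈ Ξ_K`,
each a smooth projective geometrically irreducible `d`-fold, whose complex points form a clopen partition
of `X(ℂ)`, with `e(E_q(ℂ)) = {[z, g_q K] : z ∈ 𝔹²}` (Deligne 1979 §2.1.2 "disjoint sum indexed by
`G(ℚ) \ G(𝔸^f)/K`", on the model: the `E_q` are the irreducible = connected components of `X`,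
`HodgeTheory.exists_components_isSmoothProjective`, re-indexed through `π₀(Sh_K(ℂ)) ≃ Ξ_K`,
`connectedComponents_equiv_index`). [cite: Deligne1979ShimuraVarieties, §2.1.2–2.1.3] -/
theorem exists_components_indexed {X : SchemeOver ℂ} {d : ℕ} [SmoothOfRelativeDimension d X.hom]
    (hX : IsProjectiveOver X)
    (hK : IsOpen (K : Set (finAdelic (↥(maximalRealSubfield L)) L (IsCMField.complexConj L) 3 H)))
    (e : ComplexPoints X ≃ₜ ShimuraSet L H τ T hT K)
    (g : orbitRel.Quotient (rational (↥(maximalRealSubfield L)) L (IsCMField.complexConj L) 3 H)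
          (CosetSpace (rationalToFinAdelic (↥(maximalRealSubfield L)) L (IsCMField.complexConj L) 3 H)
            K) →
        finAdelic (↥(maximalRealSubfield L)) L (IsCMField.complexConj L) 3 H)
    (hg : ∀ q, Quotient.mk'' (CosetSpace.pt (rationalToFinAdelic _ L _ 3 H) K (g q)) = q) :
    ∃ (E : orbitRel.Quotient (rational (↥(maximalRealSubfield L)) L (IsCMField.complexConj L) 3 H)
          (CosetSpace (rationalToFinAdelic (↥(maximalRealSubfield L)) L (IsCMField.complexConj L) 3 H)
            K) → SchemeOver ℂ)
      (ι : ∀ q, E q ⟶ X),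
      (∀ q, IsSmoothProjective d (E q)) ∧ (∀ q, IsOpenImmersion (ι q).left) ∧
        (∀ q, IsClosedImmersion (ι q).left) ∧
        IsClopenPartition (fun q => Set.range (AlgPoints.map (L := ℂ) (ι q))) ∧
        ∀ q, e '' Set.range (AlgPoints.map (L := ℂ) (ι q)) =
          Set.range (fun z : Ball => ShimuraSet.mk L H τ T hT K z (g q)) := by
  classical
  obtain ⟨C, E, ι, hE, hopen, hclosed, hA⟩ :=
    Literature.AlgebraicGeometry.HodgeTheory.exists_components_isSmoothProjective (d := d) hX
  obtain ⟨π, hπ⟩ := connectedComponents_equiv_index L H τ T hT K hK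
  -- the pieces `S c = E_c(ℂ) ⊆ X(ℂ)`: non-empty, connected, clopen
  haveI hconn : ∀ c, ConnectedSpace (ComplexPoints (E c)) := fun c =>
    Literature.AlgebraicGeometry.HodgeTheory.connectedSpace_complexPoints (hE c)
  let P : ∀ c, ComplexPoints (E c) := fun c => Classical.arbitrary _
  set S : C → Set (ComplexPoints X) := fun c => Set.range (AlgPoints.map (L := ℂ) (ι c)) with hS_def
  have hSconn : ∀ c, IsConnected (S c) := fun c =>
    isConnected_range (AlgPoints.continuous_map (L := ℂ) (ι c))
  have hSclopen : ∀ c, IsClopen (S c) := fun c =>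
    ⟨isClosed_of_isClopenPartition hA c, hA.isOpen c⟩
  have hPS : ∀ c, AlgPoints.map (L := ℂ) (ι c) (P c) ∈ S c := fun c => ⟨P c, rfl⟩
  -- `e(S c)` is the connected component of `e (ι_c (P c))`
  have hkey : ∀ c, e '' S c = connectedComponent (e (AlgPoints.map (L := ℂ) (ι c) (P c))) := fun c => by
    rw [eq_connectedComponent_of_isClopen (hSclopen c) (hSconn c).isPreconnected (hPS c),
      image_connectedComponent_homeomorph]
  -- the index of a component
  let f : C → orbitRel.Quotient (rational (↥(maximalRealSubfield L)) L (IsCMField.complexConj L) 3 H)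
      (CosetSpace (rationalToFinAdelic (↥(maximalRealSubfield L)) L (IsCMField.complexConj L) 3 H) K) :=
    fun c => π (ConnectedComponents.mk (e (AlgPoints.map (L := ℂ) (ι c) (P c))))
  have hf_inj : Function.Injective f := by
    intro c₁ c₂ h
    have h' := π.injective h
    rw [ConnectedComponents.coe_eq_coe] at h'
    have hS12 : S c₁ = S c₂ := e.injective.image_injective (by rw [hkey, hkey, h'])
    have hmem : AlgPoints.map (L := ℂ) (ι c₁) (P c₁) ∈ S c₂ := hS12 ▸ hPS c₁
    exact hA.eq_of_mem (hPS c₁) hmem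
  have hf_val : ∀ c q, f c = q ↔
      connectedComponent (e (AlgPoints.map (L := ℂ) (ι c) (P c))) =
        connectedComponent (ShimuraSet.mk L H τ T hT K x₀ (g q)) := by
    intro c q
    constructor
    · intro h
      have h1 : π (ConnectedComponents.mk (e (AlgPoints.map (L := ℂ) (ι c) (P c)))) =
          π (ConnectedComponents.mk (ShimuraSet.mk L H τ T hT K x₀ (g q))) := by
        rw [hπ, hg]; exact h
      have h2 := π.injective h1
      rwa [ConnectedComponents.coe_eq_coe] at h2
    · intro h
      have h2 : (ConnectedComponents.mk (e (AlgPoints.map (L := ℂ) (ι c) (P c))) :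
          ConnectedComponents (ShimuraSet L H τ T hT K)) =
          ConnectedComponents.mk (ShimuraSet.mk L H τ T hT K x₀ (g q)) :=
        ConnectedComponents.coe_eq_coe.mpr h
      change π _ = q
      rw [h2, hπ, hg]
  have hf_surj : Function.Surjective f := by
    intro q
    obtain ⟨c, hc⟩ := hA.exists_mem (e.symm (ShimuraSet.mk L H τ T hT K x₀ (g q)))
    refine ⟨c, (hf_val c q).mpr (connectedComponent_eq ?_)⟩
    rw [← hkey c]
    exact ⟨_, hc, e.apply_symm_apply _⟩
  let σ := Equiv.ofBijective f ⟨hf_inj, hf_surj⟩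
  refine ⟨fun q => E (σ.symm q), fun q => ι (σ.symm q), fun q => hE _, fun q => hopen _,
    fun q => hclosed _, ⟨fun q => hA.isOpen _, fun q₁ q₂ hne => hA.disjoint
      (fun h => hne (σ.symm.injective h)), fun z => ?_⟩, fun q => ?_⟩
  · obtain ⟨c, hc⟩ := hA.exists_mem z
    refine ⟨σ c, ?_⟩
    have hσ : σ.symm (σ c) = c := σ.symm_apply_apply c
    change z ∈ S (σ.symm (σ c))
    rw [hσ]
    exact hc
  · have hq : f (σ.symm q) = q := Equiv.ofBijective_apply_symm_apply f ⟨hf_inj, hf_surj⟩ q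
    change e '' S (σ.symm q) = _
    rw [hkey, (hf_val _ q).mp hq, connectedComponent_mk L H τ T hT K hK x₀ (g q)]

/-! ### Each component is homeomorphic to the ball quotient of its conjugate level -/

/-- **The `q`-th component of a model is `Γ_H(g_q K g_q⁻¹) \ 𝔹²` topologically, compatibly with the model
map.**  In the situation of `exists_components_indexed` one can moreover choose homeomorphisms
`φ_q : E_q(ℂ) ≃ₜ Δ(Γ_H(g_q K g_q⁻¹)) \ 𝔹²` with `ι_q(φ_q⁻¹[z]) = e⁻¹[z, g_q K]` for all `z ∈ 𝔹²`
(Deligne 1979 §2.1.2: the summand of the disjoint sum over the double coset of `g_q` is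
`Γ'_{g_q} \ X⁺`, `Γ'_g = gKg⁻¹ ∩ G(ℚ)`; the tree's dissection `UnitaryGroup.shimuraSetHomeomorph`
restricted to one summand, composed with `e` and the open embedding `E_q(ℂ) ↪ X(ℂ)`).
[cite: Deligne1979ShimuraVarieties, §2.1.2] [cite: Milne2005ShimuraVarieties, Lemma 5.13] -/
theorem exists_components_homeomorph_ballQuotient {X : SchemeOver ℂ} {d : ℕ}
    [SmoothOfRelativeDimension d X.hom] (hX : IsProjectiveOver X)
    (hK : IsOpen (K : Set (finAdelic (↥(maximalRealSubfield L)) L (IsCMField.complexConj L) 3 H)))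
    (e : ComplexPoints X ≃ₜ ShimuraSet L H τ T hT K)
    (g : orbitRel.Quotient (rational (↥(maximalRealSubfield L)) L (IsCMField.complexConj L) 3 H)
          (CosetSpace (rationalToFinAdelic (↥(maximalRealSubfield L)) L (IsCMField.complexConj L) 3 H)
            K) →
        finAdelic (↥(maximalRealSubfield L)) L (IsCMField.complexConj L) 3 H)
    (hg : ∀ q, Quotient.mk'' (CosetSpace.pt (rationalToFinAdelic _ L _ 3 H) K (g q)) = q) :
    ∃ (E : orbitRel.Quotient (rational (↥(maximalRealSubfield L)) L (IsCMField.complexConj L) 3 H)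
          (CosetSpace (rationalToFinAdelic (↥(maximalRealSubfield L)) L (IsCMField.complexConj L) 3 H)
            K) → SchemeOver ℂ)
      (ι : ∀ q, E q ⟶ X)
      (φ : ∀ q, ComplexPoints (E q) ≃ₜ
        orbitRel.Quotient
          (archImageU21 L H τ T hT
            (arithmeticLevel (↥(maximalRealSubfield L)) L (IsCMField.complexConj L) 3 H
              (K.map (MulAut.conj (g q)).toMonoidHom)))
          Ball),
      (∀ q, IsSmoothProjective d (E q)) ∧ (∀ q, IsOpenImmersion (ι q).left) ∧
        (∀ q, IsClosedImmersion (ι q).left) ∧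
        IsClopenPartition (fun q => Set.range (AlgPoints.map (L := ℂ) (ι q))) ∧
        (∀ q, e '' Set.range (AlgPoints.map (L := ℂ) (ι q)) =
          Set.range (fun z : Ball => ShimuraSet.mk L H τ T hT K z (g q))) ∧
        ∀ q (z : Ball), AlgPoints.map (L := ℂ) (ι q) ((φ q).symm (Quotient.mk'' z)) =
          e.symm (ShimuraSet.mk L H τ T hT K z (g q)) := by
  classical
  obtain ⟨E, ι, hE, hopen, hclosed, hA, himg⟩ :=
    exists_components_indexed L H τ T hT K (d := d) hX hK e g hg
  -- the dissection `Φ : Sh_K(ℂ) ≃ₜ Σ q, Δ(Γ_H(g_q K g_q⁻¹)) \ 𝔹²`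
  let Φ := shimuraSetHomeomorph L H τ T hT K hK hg
  -- the summand inclusions `j_q : Δ(Γ_H(g_q K g_q⁻¹)) \ 𝔹² → Sh_K(ℂ)`, `[z] ↦ [z, g_q K]`, are embeddings onto the pieces
  let BQ := fun q : orbitRel.Quotient (rational (↥(maximalRealSubfield L)) L (IsCMField.complexConj L) 3 H)
      (CosetSpace (rationalToFinAdelic (↥(maximalRealSubfield L)) L (IsCMField.complexConj L) 3 H) K) =>
    orbitRel.Quotient
      (archImageU21 L H τ T hT
        (arithmeticLevel (↥(maximalRealSubfield L)) L (IsCMField.complexConj L) 3 H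
          (K.map (MulAut.conj (g q)).toMonoidHom)))
      Ball
  let j : ∀ q, BQ q → ShimuraSet L H τ T hT K := fun q w => Φ.symm ⟨q, w⟩
  have hj : ∀ q, IsEmbedding (j q) := fun q =>
    Φ.symm.isEmbedding.comp (IsOpenEmbedding.sigmaMk (σ := BQ) (i := q)).isEmbedding
  have hjrange : ∀ q, Set.range (fun z : Ball => ShimuraSet.mk L H τ T hT K z (g q)) = Set.range (j q) := by
    intro q
    ext c
    constructor
    · rintro ⟨z, rfl⟩
      exact ⟨Quotient.mk'' z, shimuraSetHomeomorph_symm_apply_mk L H τ T hT K hK hg q z⟩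
    · rintro ⟨w, rfl⟩
      induction w using Quotient.inductionOn' with | h z => ?_
      exact ⟨z, (shimuraSetHomeomorph_symm_apply_mk L H τ T hT K hK hg q z).symm⟩
  -- `E_q(ℂ) ≃ₜ ι_q(E_q(ℂ)) ≃ₜ e(ι_q(E_q(ℂ))) = piece_q = range j_q ≃ₜ Δ(Γ_H(g_q K g_q⁻¹)) \ 𝔹²`
  have hemb : ∀ q, IsEmbedding (AlgPoints.map (L := ℂ) (ι q)) := fun q =>
    haveI := hopen q
    (AlgPoints.isOpenEmbedding_map_holds (L := ℂ) (ι q)).isEmbedding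
  let h1 : ∀ q, ComplexPoints (E q) ≃ₜ Set.range (AlgPoints.map (L := ℂ) (ι q)) := fun q =>
    (hemb q).toHomeomorph
  let ψ : ∀ q, ComplexPoints (E q) ≃ₜ Set.range (j q) := fun q =>
    (h1 q).trans <| (e.image _).trans <| (Homeomorph.setCongr (himg q)).trans
      (Homeomorph.setCongr (hjrange q))
  have hψ : ∀ q (x : ComplexPoints (E q)), ((ψ q x) : ShimuraSet L H τ T hT K) =
      e (AlgPoints.map (L := ℂ) (ι q) x) := fun q x => by
    simp only [ψ, h1, Homeomorph.trans_apply, Homeomorph.setCongr, Homeomorph.homeomorph_mk_coe,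
      Equiv.setCongr_apply, Homeomorph.image_apply_coe, IsEmbedding.toHomeomorph_apply_coe]
  let φ : ∀ q, ComplexPoints (E q) ≃ₜ BQ q := fun q => (ψ q).trans (hj q).toHomeomorph.symm
  have hφ : ∀ q (x : ComplexPoints (E q)), j q (φ q x) = e (AlgPoints.map (L := ℂ) (ι q) x) := by
    intro q x
    have h := congrArg Subtype.val ((hj q).toHomeomorph.apply_symm_apply (ψ q x))
    rw [IsEmbedding.toHomeomorph_apply_coe] at h
    rw [← hψ q x]
    exact h
  refine ⟨E, ι, φ, hE, hopen, hclosed, hA, himg, fun q z => ?_⟩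
  -- `ι_q (φ_q⁻¹ [z]) = e⁻¹ (j_q [z]) = e⁻¹ [z, g_q K]`
  have h := hφ q ((φ q).symm (Quotient.mk'' z))
  rw [Homeomorph.apply_symm_apply] at h
  apply e.injective
  rw [e.apply_symm_apply, ← h]
  exact shimuraSetHomeomorph_symm_apply_mk L H τ T hT K hK hg q z

end Deligne1979

end Literature.AlgebraicGeometry.ShimuraVarieties

end
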